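import Summits.ValiantsHypothesis.ValiantsHypothesis.Theorems.KPlusLogSqLawTridiagonalRealStaticUnitFive

/-!
# Route «KPlusLogSqLaw», crux `WeakLifting` (stmt-ValiantsHypothesis-19561) — REAL side of the tridiagonal sector:
# Descartes bookkeeping for the unit sub-sector — ALTERNATING CHAINS and the FOUR-BLOCK LEMMA

HONEST FRAMING.  Helper theorems (`--supports stmt-ValiantsHypothesis-19561 --as helper`), seat val-sym-lift-p1 (g16), cell `pub-symmetroid`,
2026-08-28; combinatorial half of the row `U 5 = 4` of the unit-coefficient sub-sector of the α register (companion file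
`…TridiagonalRealStaticUnitFiveExact`).  Three elementary facts about Descartes' count `Var` (Mathlib `Polynomial.signVariations`):
* `exists_altChain_of_le_signVariations` — the folklore reading of `Var`: a non-zero real polynomial with `Var ≥ n` has `n + 1` coefficients at
  strictly decreasing exponents whose signs alternate, starting from the sign of the leading coefficient (induction on `eraseLead`, Mathlib
  `signVariations_eq_eraseLead_add_ite`);
* **FOUR-BLOCK LEMMA** (`fourBlock_no_altChain`, `fourBlock_no_altChain'`): for ANY four integer intervals `I₁, I₂, J₁, J₂` the sequence
  `n ↦ [n ∈ I₁] + [n ∈ I₂] − [n ∈ J₁] − [n ∈ J₂]` has no strictly alternating sign chain of length five (two positives inside one interval force the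
  negative between them into `J₁ ∩ J₂`; a four-line case analysis, discharged by `omega` from the one-exponent bookkeeping `fourBlock_pos_at` /
  `fourBlock_neg_at`);
* hence (`signVariations_le_three_of_fourBlock`) a real polynomial `X^{E₁}[k₁] − X^{E₂}[k₂] + X^{E₃}[k₃] − X^{E₄}[k₄]` (`[k] = 1 + X + ⋯ + X^{k−1}`,
  arbitrary shifts and lengths, overlaps allowed) has `Var ≤ 3`, and (`card_posRoots_le_four_of_eq_mul_fourBlock`) a polynomial `(X − 1)·(such)` has
  at most FOUR distinct positive roots (Descartes, Mathlib `roots_countP_pos_le_signVariations`).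
The deflated determinant of every unit `5 × 5` design with opposite outer slopes is of this shape (companion file), which is how the four-block
lemma caps the unit row at size `5`.  Nothing here is an upper law for the register (α NO MOVER); nothing bears on `WeakLifting` / `TropicalB`
(stmt-19771) in their windows, Conjecture B, the Door-A registers, `MatrixDescartes` (stmt-18050) or VP ≠ VNP.
[this seat; folklore: Descartes' rule of signs, `Var` as the number of sign alternations]
-/

-- `Summit.ValiantsHypothesis.ValiantsHypothesis.…` repeats a component by the D-0017 layout (single-conjunct summit); the name is mandated.
set_option linter.dupNamespace false
set_option autoImplicit false

namespace Summit.ValiantsHypothesis.ValiantsHypothesis.Theorems.KPlusLogSqLaw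
namespace StaticTridiagonalRealUnit

open Polynomial Finset

/-! ### A. Sign variations force alternating coefficient chains -/

/-- **alternating chains** (folklore form of `Var`): a non-zero real polynomial with at least `n` sign variations has coefficients
`c_{i₀}, c_{i₁}, …, c_{i_n}` at exponents `i₀ > i₁ > ⋯ > i_n` whose signs alternate, starting with the sign of the leading coefficient.
[folklore: Descartes' rule of signs, definition of `Var`] -/
theorem exists_altChain_of_le_signVariations {P : ℝ[X]} (hP : P ≠ 0) {n : ℕ} (hn : n ≤ P.signVariations) :
    ∃ idx : ℕ → ℕ, (∀ j, j < n → idx (j + 1) < idx j) ∧ (∀ j, j ≤ n → idx j ≤ P.natDegree) ∧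
      ∀ j, j ≤ n → 0 < (-1 : ℝ) ^ j * (P.leadingCoeff * P.coeff (idx j)) := by
  induction hc : P.support.card using Nat.strong_induction_on generalizing P n with
  | _ c ih =>
    rcases Nat.eq_zero_or_pos n with hn0 | hn0
    · subst hn0
      refine ⟨fun _ => P.natDegree, fun j hj => absurd hj (Nat.not_lt_zero _), fun j _ => le_rfl, fun j hj => ?_⟩
      rw [Nat.le_zero.1 hj, pow_zero, one_mul]
      exact mul_self_pos.2 (leadingCoeff_ne_zero.2 hP)
    · obtain ⟨m, rfl⟩ : ∃ m, n = m + 1 := ⟨n - 1, by omega⟩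
      have hV := signVariations_eq_eraseLead_add_ite hP
      set E := P.eraseLead with hE
      have hE0 : E ≠ 0 := by
        intro h0
        rw [h0, signVariations_zero, leadingCoeff_zero, sign_zero, neg_zero] at hV
        rw [hV] at hn
        have : SignType.sign P.leadingCoeff ≠ 0 := by
          rw [Ne, sign_eq_zero_iff]; exact leadingCoeff_ne_zero.2 hP
        simp [this] at hn
      have hcardE : E.support.card < c := by
        have h := card_support_eraseLead_add_one hP
        rw [← hE] at h; omega
      have hdegE : E.natDegree ≤ P.natDegree := (eraseLead_natDegree_le P).trans (Nat.sub_le _ _)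
      have aux : ∀ {X s : ℝ}, s ≠ 0 → 0 < X * (s * s) → 0 < X := by
        intro X s hs h
        by_contra hX
        push Not at hX
        nlinarith [mul_self_pos.2 hs, mul_nonpos_of_nonpos_of_nonneg hX (mul_self_nonneg s)]
      have hcoeffE : ∀ i, i ≤ E.natDegree → E.coeff i = P.coeff i ∨ E.coeff i = 0 := by
        intro i _
        by_cases hi : i = P.natDegree
        · right; rw [hi, hE, eraseLead_coeff_natDegree]
        · left; rw [hE, eraseLead_coeff_of_ne i hi]
      -- sign relation between the two leading coefficients
      have hlP : P.leadingCoeff ≠ 0 := leadingCoeff_ne_zero.2 hP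
      have hlE : E.leadingCoeff ≠ 0 := leadingCoeff_ne_zero.2 hE0
      by_cases hs : SignType.sign P.leadingCoeff = -SignType.sign E.leadingCoeff
      · -- a genuine sign change on top: chain of length `m + 1` in `E`, then the leading term of `P`
        rw [if_pos hs] at hV
        have hmE : m ≤ E.signVariations := by omega
        obtain ⟨idx, hmono, hbd, hsgn⟩ := ih _ hcardE hE0 hmE rfl
        have hneg : P.leadingCoeff * E.leadingCoeff < 0 := by
          rcases hlP.lt_or_gt with h1 | h1 <;> rcases hlE.lt_or_gt with h2 | h2
          · rw [sign_neg h1, sign_neg h2] at hs; exact absurd hs (by decide)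
          · exact mul_neg_of_neg_of_pos h1 h2
          · exact mul_neg_of_pos_of_neg h1 h2
          · rw [sign_pos h1, sign_pos h2] at hs; exact absurd hs (by decide)
        have hidxlt : ∀ j, j ≤ m → idx j < P.natDegree := by
          intro j hj
          have h1 := hbd j hj
          rcases (h1.trans hdegE).lt_or_eq with h2 | h2
          · exact h2
          · exfalso
            have h3 := hsgn j hj
            have h4 : E.coeff (idx j) = 0 := by rw [h2, hE, eraseLead_coeff_natDegree]
            rw [h4, mul_zero, mul_zero] at h3
            exact lt_irrefl _ h3
        refine ⟨fun j => if j = 0 then P.natDegree else idx (j - 1), fun j hj => ?_, fun j hj => ?_, fun j hj => ?_⟩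
        · dsimp only
          rcases Nat.eq_zero_or_pos j with hj0 | hj0
          · subst hj0; simpa using hidxlt 0 (Nat.zero_le _)
          · have h1 : j - 1 < m := by omega
            have h2 := hmono (j - 1) h1
            rw [if_neg (by omega), if_neg (by omega), show j + 1 - 1 = (j - 1) + 1 by omega]
            exact h2
        · dsimp only
          rcases Nat.eq_zero_or_pos j with hj0 | hj0
          · subst hj0; simp
          · rw [if_neg (by omega)]; exact (hidxlt _ (by omega)).le
        · dsimp only
          rcases Nat.eq_zero_or_pos j with hj0 | hj0
          · subst hj0; simpa using mul_self_pos.2 hlP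
          · rw [if_neg (by omega)]
            have h1 := hsgn (j - 1) (by omega)
            have h2 : E.coeff (idx (j - 1)) = P.coeff (idx (j - 1)) := by
              rw [hE, eraseLead_coeff_of_ne _ (hidxlt _ (by omega)).ne]
            rw [h2] at h1
            -- `(−1)^j · lead P · c · (lead E)² = (−lead P · lead E) · ((−1)^(j−1) · lead E · c)`, a product of two positives
            have h3 : (-1 : ℝ) ^ j * (P.leadingCoeff * P.coeff (idx (j - 1))) * (E.leadingCoeff * E.leadingCoeff) =
                (-(P.leadingCoeff * E.leadingCoeff)) * ((-1 : ℝ) ^ (j - 1) * (E.leadingCoeff * P.coeff (idx (j - 1)))) := by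
              rw [show j = (j - 1) + 1 from by omega, pow_succ, Nat.add_sub_cancel]
              ring
            exact aux hlE (h3 ▸ mul_pos (neg_pos.2 hneg) h1)
      · -- no sign change on top: the chain of `E` serves `P`
        rw [if_neg hs] at hV
        have hmE : m + 1 ≤ E.signVariations := by omega
        obtain ⟨idx, hmono, hbd, hsgn⟩ := ih _ hcardE hE0 hmE rfl
        have hpos : 0 < P.leadingCoeff * E.leadingCoeff := by
          rcases hlP.lt_or_gt with h1 | h1 <;> rcases hlE.lt_or_gt with h2 | h2
          · exact mul_pos_of_neg_of_neg h1 h2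
          · rw [sign_neg h1, sign_pos h2] at hs; exact absurd (by decide) hs
          · rw [sign_pos h1, sign_neg h2] at hs; exact absurd (by decide) hs
          · exact mul_pos h1 h2
        have hidxlt : ∀ j, j ≤ m + 1 → idx j < P.natDegree := by
          intro j hj
          have h1 := hbd j hj
          rcases (h1.trans hdegE).lt_or_eq with h2 | h2
          · exact h2
          · exfalso
            have h3 := hsgn j hj
            have h4 : E.coeff (idx j) = 0 := by rw [h2, hE, eraseLead_coeff_natDegree]
            rw [h4, mul_zero, mul_zero] at h3
            exact lt_irrefl _ h3
        refine ⟨idx, hmono, fun j hj => (hidxlt j hj).le, fun j hj => ?_⟩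
        have h1 := hsgn j hj
        have h2 : E.coeff (idx j) = P.coeff (idx j) := by
          rw [hE, eraseLead_coeff_of_ne _ (hidxlt _ hj).ne]
        rw [h2] at h1
        have h3 : (-1 : ℝ) ^ j * (P.leadingCoeff * P.coeff (idx j)) * (E.leadingCoeff * E.leadingCoeff) =
            (P.leadingCoeff * E.leadingCoeff) * ((-1 : ℝ) ^ j * (E.leadingCoeff * P.coeff (idx j))) := by
          ring
        exact aux hlE (h3 ▸ mul_pos hpos h1)

/-! ### B. The four-block lemma: two positive and two negative blocks of consecutive unit coefficients never alternate five times -/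

/-- sign bookkeeping at ONE exponent of a four-block coefficient: a positive value needs a positive block, and a negative block on top of it
needs BOTH positive blocks and excludes the other negative block. [this file; elementary] -/
theorem fourBlock_pos_at {p₁ q₁ p₂ q₂ m₁ n₁ m₂ n₂ n : ℕ}
    (h : (0 : ℝ) < (if p₁ ≤ n ∧ n < q₁ then (1 : ℝ) else 0) + (if p₂ ≤ n ∧ n < q₂ then (1 : ℝ) else 0) -
      (if m₁ ≤ n ∧ n < n₁ then (1 : ℝ) else 0) - (if m₂ ≤ n ∧ n < n₂ then (1 : ℝ) else 0)) :
    ((p₁ ≤ n ∧ n < q₁) ∨ (p₂ ≤ n ∧ n < q₂)) ∧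
      ((m₁ ≤ n ∧ n < n₁) → (p₁ ≤ n ∧ n < q₁) ∧ (p₂ ≤ n ∧ n < q₂) ∧ ¬(m₂ ≤ n ∧ n < n₂)) ∧
      ((m₂ ≤ n ∧ n < n₂) → (p₁ ≤ n ∧ n < q₁) ∧ (p₂ ≤ n ∧ n < q₂) ∧ ¬(m₁ ≤ n ∧ n < n₁)) := by
  by_cases h1 : p₁ ≤ n ∧ n < q₁ <;> by_cases h2 : p₂ ≤ n ∧ n < q₂ <;> by_cases h3 : m₁ ≤ n ∧ n < n₁ <;>
    by_cases h4 : m₂ ≤ n ∧ n < n₂ <;> simp [h1, h2, h3, h4] at h ⊢ <;> norm_num at h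

/-- the same bookkeeping for a negative value. [this file; elementary] -/
theorem fourBlock_neg_at {p₁ q₁ p₂ q₂ m₁ n₁ m₂ n₂ n : ℕ}
    (h : (if p₁ ≤ n ∧ n < q₁ then (1 : ℝ) else 0) + (if p₂ ≤ n ∧ n < q₂ then (1 : ℝ) else 0) -
      (if m₁ ≤ n ∧ n < n₁ then (1 : ℝ) else 0) - (if m₂ ≤ n ∧ n < n₂ then (1 : ℝ) else 0) < 0) :
    ((m₁ ≤ n ∧ n < n₁) ∨ (m₂ ≤ n ∧ n < n₂)) ∧
      ((p₁ ≤ n ∧ n < q₁) → (m₁ ≤ n ∧ n < n₁) ∧ (m₂ ≤ n ∧ n < n₂) ∧ ¬(p₂ ≤ n ∧ n < q₂)) ∧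
      ((p₂ ≤ n ∧ n < q₂) → (m₁ ≤ n ∧ n < n₁) ∧ (m₂ ≤ n ∧ n < n₂) ∧ ¬(p₁ ≤ n ∧ n < q₁)) := by
  by_cases h1 : p₁ ≤ n ∧ n < q₁ <;> by_cases h2 : p₂ ≤ n ∧ n < q₂ <;> by_cases h3 : m₁ ≤ n ∧ n < n₁ <;>
    by_cases h4 : m₂ ≤ n ∧ n < n₂ <;> simp [h1, h2, h3, h4] at h ⊢ <;> norm_num at h

/-- **FOUR-BLOCK LEMMA.**  For any four integer intervals `I₁, I₂` (counted `+1`) and `J₁, J₂` (counted `−1`) the sequence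
`n ↦ [n ∈ I₁] + [n ∈ I₂] − [n ∈ J₁] − [n ∈ J₂]` has NO strictly alternating sign chain `+ − + − +` along increasing `n`.  (Two positives in one interval
force every negative between them into `J₁ ∩ J₂`; the case analysis on which negative block holds the two negative members closes.) [this file] -/
theorem fourBlock_no_altChain (p₁ q₁ p₂ q₂ m₁ n₁ m₂ n₂ : ℕ) (c : ℕ → ℝ)
    (hc : ∀ n, c n = (if p₁ ≤ n ∧ n < q₁ then (1 : ℝ) else 0) + (if p₂ ≤ n ∧ n < q₂ then (1 : ℝ) else 0) -
      (if m₁ ≤ n ∧ n < n₁ then (1 : ℝ) else 0) - (if m₂ ≤ n ∧ n < n₂ then (1 : ℝ) else 0))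
    {s₀ s₁ s₂ s₃ s₄ : ℕ} (h01 : s₀ < s₁) (h12 : s₁ < s₂) (h23 : s₂ < s₃) (h34 : s₃ < s₄)
    (hs₀ : 0 < c s₀) (hs₁ : c s₁ < 0) (hs₂ : 0 < c s₂) (hs₃ : c s₃ < 0) (hs₄ : 0 < c s₄) : False := by
  have F0 := fourBlock_pos_at ((hc s₀) ▸ hs₀)
  have F1 := fourBlock_neg_at ((hc s₁) ▸ hs₁)
  have F2 := fourBlock_pos_at ((hc s₂) ▸ hs₂)
  have F3 := fourBlock_neg_at ((hc s₃) ▸ hs₃)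
  have F4 := fourBlock_pos_at ((hc s₄) ▸ hs₄)
  omega

/-- the mirrored chain `− + − + −` is excluded as well (apply the lemma to `−c`, exchanging the roles of the blocks). [this file] -/
theorem fourBlock_no_altChain' (p₁ q₁ p₂ q₂ m₁ n₁ m₂ n₂ : ℕ) (c : ℕ → ℝ)
    (hc : ∀ n, c n = (if p₁ ≤ n ∧ n < q₁ then (1 : ℝ) else 0) + (if p₂ ≤ n ∧ n < q₂ then (1 : ℝ) else 0) -
      (if m₁ ≤ n ∧ n < n₁ then (1 : ℝ) else 0) - (if m₂ ≤ n ∧ n < n₂ then (1 : ℝ) else 0))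
    {s₀ s₁ s₂ s₃ s₄ : ℕ} (h01 : s₀ < s₁) (h12 : s₁ < s₂) (h23 : s₂ < s₃) (h34 : s₃ < s₄)
    (hs₀ : c s₀ < 0) (hs₁ : 0 < c s₁) (hs₂ : c s₂ < 0) (hs₃ : 0 < c s₃) (hs₄ : c s₄ < 0) : False := by
  refine fourBlock_no_altChain m₁ n₁ m₂ n₂ p₁ q₁ p₂ q₂ (fun n => -c n) (fun n => ?_) h01 h12 h23 h34
    (neg_pos.2 hs₀) (neg_lt_zero.2 hs₁) (neg_pos.2 hs₂) (neg_lt_zero.2 hs₃) (neg_pos.2 hs₄)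
  rw [hc n]; ring

/-- **Descartes count of a four-block polynomial**: a real polynomial whose coefficient sequence is `[n ∈ I₁] + [n ∈ I₂] − [n ∈ J₁] − [n ∈ J₂]` for
four integer intervals has at most THREE sign variations. [this file] -/
theorem signVariations_le_three_of_fourBlock (R : ℝ[X]) (p₁ q₁ p₂ q₂ m₁ n₁ m₂ n₂ : ℕ)
    (hR : ∀ n, R.coeff n = (if p₁ ≤ n ∧ n < q₁ then (1 : ℝ) else 0) + (if p₂ ≤ n ∧ n < q₂ then (1 : ℝ) else 0) -
      (if m₁ ≤ n ∧ n < n₁ then (1 : ℝ) else 0) - (if m₂ ≤ n ∧ n < n₂ then (1 : ℝ) else 0)) :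
    R.signVariations ≤ 3 := by
  by_contra h4
  have h4' : 4 ≤ R.signVariations := by omega
  have hR0 : R ≠ 0 := by rintro rfl; simp at h4'
  obtain ⟨idx, hmono, -, hsgn⟩ := exists_altChain_of_le_signVariations hR0 h4'
  have hlc : R.leadingCoeff ≠ 0 := leadingCoeff_ne_zero.2 hR0
  have g0 := hsgn 0 (by norm_num)
  have g1 := hsgn 1 (by norm_num)
  have g2 := hsgn 2 (by norm_num)
  have g3 := hsgn 3 (by norm_num)
  have g4 := hsgn 4 (by norm_num)
  simp only [pow_zero, one_mul, pow_one, neg_mul, neg_pos] at g0 g1 g2 g3 g4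
  have e2 : (-1 : ℝ) ^ 2 = 1 := by norm_num
  have e3 : (-1 : ℝ) ^ 3 = -1 := by norm_num
  have e4 : (-1 : ℝ) ^ 4 = 1 := by norm_num
  rw [e2, one_mul] at g2
  rw [e3, neg_mul, one_mul, neg_pos] at g3
  rw [e4, one_mul] at g4
  rcases hlc.lt_or_gt with hl | hl
  · -- negative leading coefficient: signs `− + − + −` along the increasing exponents `idx 4 < ⋯ < idx 0`
    have t0 : R.coeff (idx 0) < 0 := by nlinarith
    have t1 : 0 < R.coeff (idx 1) := by nlinarith
    have t2 : R.coeff (idx 2) < 0 := by nlinarith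
    have t3 : 0 < R.coeff (idx 3) := by nlinarith
    have t4 : R.coeff (idx 4) < 0 := by nlinarith
    exact fourBlock_no_altChain' p₁ q₁ p₂ q₂ m₁ n₁ m₂ n₂ (fun n => R.coeff n) hR
      (hmono 3 (by norm_num)) (hmono 2 (by norm_num)) (hmono 1 (by norm_num)) (hmono 0 (by norm_num)) t4 t3 t2 t1 t0
  · -- positive leading coefficient: signs `+ − + − +`
    have t0 : 0 < R.coeff (idx 0) := by nlinarith
    have t1 : R.coeff (idx 1) < 0 := by nlinarith
    have t2 : 0 < R.coeff (idx 2) := by nlinarith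
    have t3 : R.coeff (idx 3) < 0 := by nlinarith
    have t4 : 0 < R.coeff (idx 4) := by nlinarith
    exact fourBlock_no_altChain p₁ q₁ p₂ q₂ m₁ n₁ m₂ n₂ (fun n => R.coeff n) hR
      (hmono 3 (by norm_num)) (hmono 2 (by norm_num)) (hmono 1 (by norm_num)) (hmono 0 (by norm_num)) t4 t3 t2 t1 t0

/-! ### C. Four shifted blocks of consecutive unit coefficients: `Var ≤ 3`, at most four positive roots after one factor `X − 1` -/

/-- coefficients of a shifted block `X^p · (1 + X + ⋯ + X^{k−1})`. [folklore] -/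
theorem coeff_X_pow_mul_geom_sum (p k n : ℕ) :
    ((X : ℝ[X]) ^ p * ∑ i ∈ range k, (X : ℝ[X]) ^ i).coeff n = if p ≤ n ∧ n < p + k then 1 else 0 := by
  rw [coeff_X_pow_mul', finsetSum_coeff]
  simp only [coeff_X_pow]
  rw [Finset.sum_ite_eq (range k) (n - p) (fun _ => (1 : ℝ))]
  simp only [mem_range]
  by_cases h1 : p ≤ n <;> by_cases h2 : n < p + k <;> simp [h1, h2] <;> omega

/-- the coefficient sequence of a signed sum of four shifted blocks is a four-block sequence. [this file] -/
theorem coeff_fourBlock (E₁ E₂ E₃ E₄ k₁ k₂ k₃ k₄ n : ℕ) :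
    ((X : ℝ[X]) ^ E₁ * ∑ i ∈ range k₁, (X : ℝ[X]) ^ i - X ^ E₂ * ∑ i ∈ range k₂, (X : ℝ[X]) ^ i +
        X ^ E₃ * ∑ i ∈ range k₃, (X : ℝ[X]) ^ i - X ^ E₄ * ∑ i ∈ range k₄, (X : ℝ[X]) ^ i).coeff n =
      (if E₁ ≤ n ∧ n < E₁ + k₁ then (1 : ℝ) else 0) + (if E₃ ≤ n ∧ n < E₃ + k₃ then (1 : ℝ) else 0) -
        (if E₂ ≤ n ∧ n < E₂ + k₂ then (1 : ℝ) else 0) - (if E₄ ≤ n ∧ n < E₄ + k₄ then (1 : ℝ) else 0) := by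
  simp only [coeff_add, coeff_sub, coeff_X_pow_mul_geom_sum]
  ring

/-- **counting step**: if `D = (X − 1)·R` with `R` a signed sum of four shifted unit blocks (two of each sign), then `D` has at most FOUR distinct
positive roots — `x = 1` and at most three more (Descartes: `Var R ≤ 3` by the four-block lemma). [this file] -/
theorem card_posRoots_le_four_of_eq_mul_fourBlock (D : ℝ[X]) (E₁ E₂ E₃ E₄ k₁ k₂ k₃ k₄ : ℕ)
    (hD : D = (X - C 1) * ((X : ℝ[X]) ^ E₁ * ∑ i ∈ range k₁, (X : ℝ[X]) ^ i - X ^ E₂ * ∑ i ∈ range k₂, (X : ℝ[X]) ^ i +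
        X ^ E₃ * ∑ i ∈ range k₃, (X : ℝ[X]) ^ i - X ^ E₄ * ∑ i ∈ range k₄, (X : ℝ[X]) ^ i)) :
    (D.roots.toFinset.filter (fun x => 0 < x)).card ≤ 4 := by
  set R := (X : ℝ[X]) ^ E₁ * ∑ i ∈ range k₁, (X : ℝ[X]) ^ i - X ^ E₂ * ∑ i ∈ range k₂, (X : ℝ[X]) ^ i +
        X ^ E₃ * ∑ i ∈ range k₃, (X : ℝ[X]) ^ i - X ^ E₄ * ∑ i ∈ range k₄, (X : ℝ[X]) ^ i with hRdef
  by_cases hD0 : D = 0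
  · rw [hD0, roots_zero]; simp
  have hR0 : R ≠ 0 := fun h => hD0 (by rw [hD, h, mul_zero])
  have hX1 : (X - C (1 : ℝ)) * R ≠ 0 := by rw [← hD]; exact hD0
  have hV : R.signVariations ≤ 3 :=
    signVariations_le_three_of_fourBlock R E₁ (E₁ + k₁) E₃ (E₃ + k₃) E₂ (E₂ + k₂) E₄ (E₄ + k₄)
      (fun n => by rw [hRdef]; exact coeff_fourBlock E₁ E₂ E₃ E₄ k₁ k₂ k₃ k₄ n)
  have hsub : D.roots.toFinset.filter (fun x => 0 < x) ⊆ insert 1 (R.roots.toFinset.filter (fun x => 0 < x)) := by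
    intro x hx
    simp only [Finset.mem_filter, Multiset.mem_toFinset] at hx
    rw [hD, roots_mul hX1, roots_X_sub_C, Multiset.mem_add, Multiset.mem_singleton] at hx
    rcases hx.1 with h1 | h1
    · rw [h1]; exact Finset.mem_insert_self _ _
    · exact Finset.mem_insert_of_mem (Finset.mem_filter.2 ⟨Multiset.mem_toFinset.2 h1, hx.2⟩)
  have hcount : R.roots.countP (fun x => 0 < x) ≤ 3 := R.roots_countP_pos_le_signVariations.trans hV
  have hcard : (R.roots.toFinset.filter (fun x => 0 < x)).card ≤ R.roots.countP (fun x => 0 < x) := by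
    rw [← Multiset.toFinset_filter, Multiset.countP_eq_card_filter]
    exact Multiset.toFinset_card_le _
  exact (Finset.card_le_card hsub).trans ((Finset.card_insert_le _ _).trans (by omega))


end StaticTridiagonalRealUnit
end Summit.ValiantsHypothesis.ValiantsHypothesis.Theorems.KPlusLogSqLaw
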